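import Literature.NumberTheory.LFunctions.CertifiedDirichletLTuringNumerics
import Literature.NumberTheory.LFunctions.BookerLemmaProofs
import HarnessLib

/-!
# Turing's method for Dirichlet `L`-functions — UNCONDITIONAL forms (Booker's inequality discharged)

The files `CertifiedDirichletLTuringAssembled.lean` and `CertifiedDirichletLTuringNumerics.lean` state
Trudgian's Theorem 3.8 (pair form) and the GRH-verification step for a primitive `χ` conditionally on
the named fact `Trudgian2011_lemma_2_10` (Booker's inequality, Trudgian's Lemma 2.7/2.10).  That fact
is PROVED in the tree (`Trudgian2011_lemma_2_10_holds`, `BookerLemmaProofs.lean`: maximum modulus on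
rectangles in place of Booker's numerical step), so the analytic side of Turing's method for Dirichlet
`L`-functions holds outright.  This file records the unconditional forms (standard axioms only; the
numerical constants keep the hypothesis `trudgianCheck = true`, the tree's certified `ζ` computation,
which `TuringMethodTrudgianNumericsCheck.lean` evaluates by `native_decide`):

* `TuringDirichlet.pi_mul_integral_lfunctionArgS_pair_le'` — Trudgian 2011 Theorem 3.8, pair form,
  parametric in `(c, d, t₀)`, unconditional.
* `LFunctionRHUpTo.of_turing_trudgian` — the GRH-verification step for `χ` up to height `T` from
  certified zero data and one real inequality, unconditional.
* `TuringDirichlet.integral_lfunctionArgS_pair_le_numeric`, `LFunctionRHUpTo.of_turing_numeric` —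
  the numerical forms `2·(2.26 + 0.0642 log(qt₂/2π))`, granted `trudgianCheck = true` only.

## References
* T. S. Trudgian, Improvements to Turing's method, Math. Comp. 80 (2011), §3.4 Theorem 3.8, §3.5.
  [Trudgian2011]
* D. J. Platt, Math. Comp. 85 (2016), Theorem 3.2. [Platt2016GRH]
* A. R. Booker, Experiment. Math. 15 (2006), Lemma 4.4, Theorem 4.6. [Booker2006]
-/

noncomputable section

open Complex Set MeasureTheory intervalIntegral Filter Topology
open scoped Real

namespace Literature.NumberTheory.LFunctions

open DirichletTheta DirichletCharacter ExplicitPsiChar Trudgian2011Dirichlet TrudgianNumerics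

namespace TuringDirichlet

variable {q : ℕ} [NeZero q] {χ : DirichletCharacter ℂ q}

/-- **Trudgian 2011, Theorem 3.8 in pair form — unconditional.**  For a primitive `χ` modulo `Q > 1`,
`1 < c ≤ 5/4`, `½ < d ≤ 1`, `1 ≤ t₀ < t₁ ≤ t₂`, `t₁`, `t₂` ordinates of no zero of `L(s,χ)` or
`L(s,χ̄)` with `0 < Re s < 1`:
`π(∫_{t₁}^{t₂} S(t,χ)dt + ∫_{t₁}^{t₂} S(t,χ̄)dt) ≤ 2(a₁ + a₂) + 2(b₁ + b₂) log(Qt₂/2π)`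
(constants as in `pi_mul_integral_lfunctionArgS_pair_le`; Booker's inequality supplied by the tree's
`Trudgian2011_lemma_2_10_holds`). [cite: Trudgian2011, §3.4 Theorem 3.8] -/
theorem pi_mul_integral_lfunctionArgS_pair_le' (hq : 1 < q) (hχ : χ.IsPrimitive)
    {c d t₀ t₁ t₂ : ℝ} (hc1 : 1 < c) (hc : c ≤ 5 / 4) (hd : 1 / 2 < d) (hd1 : d ≤ 1) (ht₀ : 1 ≤ t₀)
    (h01 : t₀ < t₁) (h12 : t₁ ≤ t₂)
    (hz₁ : ∀ ρ ∈ charNontrivialZeros χ, ρ.im ≠ t₁) (hz₁' : ∀ ρ ∈ charNontrivialZeros χ⁻¹, ρ.im ≠ t₁)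
    (hz₂ : ∀ ρ ∈ charNontrivialZeros χ, ρ.im ≠ t₂) (hz₂' : ∀ ρ ∈ charNontrivialZeros χ⁻¹, ρ.im ≠ t₂) :
    π * ((∫ t in t₁..t₂, lfunctionArgS χ t) + ∫ t in t₁..t₂, lfunctionArgS χ⁻¹ t) ≤
      2 * ((729 / (2048 * t₀ ^ 2) + (c - 1 / 2) * logZeta c + ∫ σ in Ioi c, logZeta σ) +
          (d ^ 2 * Real.log 4 *
              ((2 * (deriv riemannZeta (2 * (1 / 2 + d) : ℝ) / riemannZeta (2 * (1 / 2 + d) : ℝ)).re -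
                  (deriv riemannZeta (1 / 2 + d : ℝ) / riemannZeta (1 / 2 + d : ℝ)).re) +
                turingEps' t₀) +
            d ^ 2 * turingEps t₀ - turingI d)) +
        2 * ((c - 1 / 2) ^ 2 / 4 + d ^ 2 / 2 * (Real.log 4 - 1)) * Real.log (q * t₂ / (2 * π)) :=
  pi_mul_integral_lfunctionArgS_pair_le Trudgian2011_lemma_2_10_holds hq hχ hc1 hc hd hd1 ht₀ h01 h12
    hz₁ hz₁' hz₂ hz₂'

/-- **The numerical pair bound, granted only the certified `ζ` computation**: for a primitive `χ`
modulo `q > 1` and `50 < t₁ ≤ t₂` (ordinates of no zero of `L(s,χ)L(s,χ̄)` in the critical strip),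
`∫_{t₁}^{t₂} S(t,χ) dt + ∫_{t₁}^{t₂} S(t,χ̄) dt ≤ 2·(2.26 + 0.0642·log(qt₂/2π))`.
[cite: Trudgian2011, §3.5 and Theorem 3.3] -/
theorem integral_lfunctionArgS_pair_le_numeric (hcheck : trudgianCheck = true) (hq : 1 < q)
    (hχ : χ.IsPrimitive) {t₁ t₂ : ℝ} (h01 : 50 < t₁) (h12 : t₁ ≤ t₂)
    (hz₁ : ∀ ρ ∈ charNontrivialZeros χ, ρ.im ≠ t₁) (hz₁' : ∀ ρ ∈ charNontrivialZeros χ⁻¹, ρ.im ≠ t₁)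
    (hz₂ : ∀ ρ ∈ charNontrivialZeros χ, ρ.im ≠ t₂) (hz₂' : ∀ ρ ∈ charNontrivialZeros χ⁻¹, ρ.im ≠ t₂) :
    (∫ t in t₁..t₂, lfunctionArgS χ t) + ∫ t in t₁..t₂, lfunctionArgS χ⁻¹ t ≤
      2 * (2.26 + 0.0642 * Real.log (q * t₂ / (2 * π))) :=
  integral_lfunctionArgS_pair_le_numeric_of_check hcheck Trudgian2011_lemma_2_10_holds hq hχ h01 h12
    hz₁ hz₁' hz₂ hz₂'

end TuringDirichlet

open TuringDirichlet Trudgian2011Dirichlet in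
/-- **The GRH-verification step for `L(s,χ)` up to height `T` — unconditional analytic form**
(Platt 2016 Thm. 3.2 with Trudgian's Thm. 3.8; Booker's inequality is the tree's
`Trudgian2011_lemma_2_10_holds`): data (i)–(iii) of `LFunctionRHUpTo.of_turing_booker` certify
`LFunctionRHUpTo χ T ∧ N_χ(T) = N_{χ,0}(T) = n`. [cite: Platt2016GRH, Theorem 3.2]
[cite: Trudgian2011, §3.4 Theorem 3.8] -/
theorem LFunctionRHUpTo.of_turing_trudgian {q : ℕ} [NeZero q] {χ : DirichletCharacter ℂ q}
    (hχ : χ.IsPrimitive) (hq : 1 < q) {c d t₀ T h : ℝ} {n : ℕ}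
    (hc1 : 1 < c) (hc : c ≤ 5 / 4) (hd : 1 / 2 < d) (hd1 : d ≤ 1) (ht₀ : 1 ≤ t₀) (hT : t₀ < T)
    (hh : 0 < h)
    (hz : ∀ ρ ∈ charNontrivialZeros χ, ρ.im ≠ T ∧ ρ.im ≠ -T)
    (hzh : ∀ ρ ∈ charNontrivialZeros χ, ρ.im ≠ T + h ∧ ρ.im ≠ -(T + h))
    (W : Finset ℝ) (hW : ∀ γ ∈ W, χ.LFunction (1 / 2 + γ * I) = 0 ∧ |γ| ≤ T) (hWn : W.card = n)
    (Z : Finset ℝ) (hZ : ∀ γ ∈ Z, χ.LFunction (1 / 2 + γ * I) = 0 ∧ T < γ ∧ γ ≤ T + h)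
    (Z' : Finset ℝ) (hZ' : ∀ γ ∈ Z', χ⁻¹.LFunction (1 / 2 + γ * I) = 0 ∧ T < γ ∧ γ ≤ T + h)
    (hnum : (2 * ((729 / (2048 * t₀ ^ 2) + (c - 1 / 2) * logZeta c + ∫ σ in Ioi c, logZeta σ) +
          (d ^ 2 * Real.log 4 *
              ((2 * (deriv riemannZeta (2 * (1 / 2 + d) : ℝ) / riemannZeta (2 * (1 / 2 + d) : ℝ)).re -
                  (deriv riemannZeta (1 / 2 + d : ℝ) / riemannZeta (1 / 2 + d : ℝ)).re) +
                turingEps' t₀) +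
            d ^ 2 * turingEps t₀ - turingI d)) +
        2 * ((c - 1 / 2) ^ 2 / 4 + d ^ 2 / 2 * (Real.log 4 - 1)) * Real.log (q * (T + h) / (2 * π))) / π +
        2 / π * (∫ t in T..T + h, lfunctionTheta χ t) - ∑ γ ∈ Z, (T + h - γ) -
        ∑ γ ∈ Z', (T + h - γ) < h * (n + 1)) :
    LFunctionRHUpTo χ T ∧ lfunctionZeroCount χ T = n ∧ lfunctionCriticalZeroCount χ T = n :=
  LFunctionRHUpTo.of_turing_booker Trudgian2011_lemma_2_10_holds hχ hq hc1 hc hd hd1 ht₀ hT hh hz hzh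
    W hW hWn Z hZ Z' hZ' hnum

open TuringDirichlet TrudgianNumerics in
/-- **The GRH-verification step for `L(s,χ)` up to height `T > 50` with the numerical Turing bound**,
granted only the tree's certified `ζ` computation `trudgianCheck = true`: found zeros `W`, `Z`, `Z'`
and the single real inequality
`2(2.26 + 0.0642 log(q(T+h)/2π)) + (2/π)∫_T^{T+h} θ(t,χ)dt − Σ_Z(T+h−γ) − Σ_{Z'}(T+h−γ) < h(n+1)`
certify `LFunctionRHUpTo χ T ∧ N_χ(T) = N_{χ,0}(T) = n`.
[cite: Platt2016GRH, Theorem 3.2] [cite: Trudgian2011, Theorem 3.3] -/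
theorem LFunctionRHUpTo.of_turing_numeric (hcheck : TrudgianNumerics.trudgianCheck = true)
    {q : ℕ} [NeZero q] {χ : DirichletCharacter ℂ q}
    (hχ : χ.IsPrimitive) (hq : 1 < q) {T h : ℝ} {n : ℕ} (hT : 50 < T) (hh : 0 < h)
    (hz : ∀ ρ ∈ charNontrivialZeros χ, ρ.im ≠ T ∧ ρ.im ≠ -T)
    (hzh : ∀ ρ ∈ charNontrivialZeros χ, ρ.im ≠ T + h ∧ ρ.im ≠ -(T + h))
    (W : Finset ℝ) (hW : ∀ γ ∈ W, χ.LFunction (1 / 2 + γ * I) = 0 ∧ |γ| ≤ T) (hWn : W.card = n)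
    (Z : Finset ℝ) (hZ : ∀ γ ∈ Z, χ.LFunction (1 / 2 + γ * I) = 0 ∧ T < γ ∧ γ ≤ T + h)
    (Z' : Finset ℝ) (hZ' : ∀ γ ∈ Z', χ⁻¹.LFunction (1 / 2 + γ * I) = 0 ∧ T < γ ∧ γ ≤ T + h)
    (hnum : 2 * (2.26 + 0.0642 * Real.log (q * (T + h) / (2 * π))) +
        2 / π * (∫ t in T..T + h, lfunctionTheta χ t) - ∑ γ ∈ Z, (T + h - γ) -
        ∑ γ ∈ Z', (T + h - γ) < h * (n + 1)) :
    LFunctionRHUpTo χ T ∧ lfunctionZeroCount χ T = n ∧ lfunctionCriticalZeroCount χ T = n :=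
  LFunctionRHUpTo.of_turing_numeric_of_check hcheck Trudgian2011_lemma_2_10_holds hχ hq hT hh hz hzh
    W hW hWn Z hZ Z' hZ' hnum

end Literature.NumberTheory.LFunctions

end
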